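import Summits.QuantumFields.YangMills.Theorems.CoarseStiffnessTailCappedCoarseStiffnessLCommVolumeUpperCore

/-!
# Route `CoarseStiffnessTail` — THE `s⁻²` DECAY OF THE COMMUTING-TRIPLE INTEGRAL ON `SU(2)³`:
# `J(s) = ∫_{SU(2)³} exp(−s·Σ_{k<l}(1 − reTr[g_k,g_l])) dHaar³ ≤ C/s²`
# (lead's certificate, seat `ym-line-cst-p1` g15; helper on 25301 `CappedCoarseStiffnessL`, stub S3 = uniform mean action, P2/(W2))

THE THEOREM (`integral_boltz_le_of_eq_three`, `n = 3`, all `s > 0`): with `reTr = Re tr/2` the normalised trace of the tree's `SU(2)`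
model and its Haar probability measure `HaarData.haar`,

  `∫_{SU(2)^n} exp(−s·Σ_{k<l}(1 − reTr(g_k g_l g_k⁻¹ g_l⁻¹))) dHaar^{⊗n}(g) ≤ C/s²`      (`C` absolute).

This is the finite-dimensional core of the EXACT Laplace exponent of Bałaban's unit-lattice torus partition function in the hyper-weak
coupling corner: combined with `Z_P(β) ≤ linkMass(β/2)^{(d−1)(|T|−1)}·J_d(β/(2N n² #pairs))` (`…LSharpUpperBound`) it gives
`log Z_P(β) ≤ −(3/2)(3|T|−1)·log β − 2 log β + O(|T|)`, matching the lower bound (`…LSharpLowerBound` + `…LCommVolumeLower`) to `O(|T|)`.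

PROOF (the `ε⁴` law of almost-commuting triples, upper half; the estimates are in `…LCommVolumeUpperCore`).
1. SYMMETRISATION: `−1 ∈ SU(2)` is central, `reTr(−g) = −reTr g`, `[−g,h] = [g,h]` (`exists_central_neg`, `comm_word_central`); three
   halvings give `J ≤ 8·∫ e^{−sΣ}·Π_k 1[reTr g_k ≥ 0]`.
2. ORDERING (`boltz_le_sum_three`): on `{reTr g_k ≥ 0 ∀k}` let `m` minimise `reTr g_m`; dropping the commutator not containing `m`:
   `e^{−sΣ} ≤ Σ_m 1[reTr g_m ≥ 0]·Π_{l≠m} 1[reTr g_m ≤ reTr g_l]·e^{−s(1−reTr[g_m,g_l])}` (`reTr[g,h] = reTr[h,g]`).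
3. TONELLI: each summand integrates to `I = ∫ 1[reTr y ≥ 0]ψ(y)² dy`, `ψ(y) = ∫ 1[reTr y ≤ reTr h]e^{−s(1−reTr[y,h])} dh`.
4. `ψ(e^{iA}) ≤ 3π³/(32 s|A|)` and `I ≤ (3π³/32)²/(2π²)·s⁻²·∫_{|A|<π}|A|⁻² d³A`; total `J ≤ 24·I`.

HONEST SCOPE.  Haar-measure calculus on `SU(2)³`; nothing of Bałaban's is asserted; the crux 25301, its stubs S1/S2/S3, `HistoryTailL` 19936
stay OPEN; `YM3TorusSU2` (R3, RECORD rung, not Clay) is NOT proved; the Yang–Mills mass gap is NOT touched.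

References: T. Bałaban, CMP **102** (1985) 255–275 [Balaban1985UV3] (p.260, `σ(A)dA`); [folklore] (almost-commuting tuples in compact groups).
-/

noncomputable section

open MeasureTheory Real
open scoped ENNReal BigOperators

namespace Summit.QuantumFields.YangMills.Theorems.CoarseStiffnessTailCommVolumeUpper

open Literature.MathematicalPhysics.QuantumFieldTheory (haarProbability)
open Literature.MathematicalPhysics.QuantumFieldTheory.Balaban1983to89
open Literature.MathematicalPhysics.QuantumFieldTheory.Balaban1983to89.B10Eq18SigmaSU2Haar (expPauli)
open Summit.QuantumFields.YangMills.Theorems.CoarseStiffnessTailCommVolumeUpperCore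

/-! ## §0 Algebra: symmetry of the commutator, the central involution `−1`, the three pairs of `Fin 3` -/

section Algebra

/-- `reTr(g h g⁻¹ h⁻¹) = reTr(h g h⁻¹ g⁻¹)` (the two words are mutually inverse). [folklore] -/
theorem reTr_comm_symm {G : Type*} [GaugeGroup G] (g h : G) :
    reTr (g * h * g⁻¹ * h⁻¹) = reTr (h * g * h⁻¹ * g⁻¹) := by
  rw [← GaugeGroup.reTr_inv (g * h * g⁻¹ * h⁻¹)]
  congr 1
  group

/-- Central factors drop out of a commutator word: `(ux)(vy)(ux)⁻¹(vy)⁻¹ = x y x⁻¹ y⁻¹` for central `u, v`. [folklore] -/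
theorem comm_word_central {G : Type*} [Group G] (u v x y : G) (hu : ∀ w, u * w = w * u) (hv : ∀ w, v * w = w * v) :
    (u * x) * (v * y) * (u * x)⁻¹ * (v * y)⁻¹ = x * y * x⁻¹ * y⁻¹ := by
  have key : ∀ (c w : G), (∀ t, c * t = t * c) → c * w * c⁻¹ = w := fun c w h => by
    rw [h w, mul_inv_cancel_right]
  calc (u * x) * (v * y) * (u * x)⁻¹ * (v * y)⁻¹
      = (u * (x * (v * y) * x⁻¹) * u⁻¹) * (v * y)⁻¹ := by simp only [mul_inv_rev, mul_assoc]
    _ = (x * (v * y) * x⁻¹) * (v * y)⁻¹ := by rw [key u _ hu]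
    _ = x * (v * (y * x⁻¹ * y⁻¹) * v⁻¹) := by simp only [mul_inv_rev, mul_assoc]
    _ = x * (y * x⁻¹ * y⁻¹) := by rw [key v _ hv]
    _ = x * y * x⁻¹ * y⁻¹ := by simp only [mul_assoc]

/-- **`−1 ∈ SU(2)`**: a central involution flipping the sign of the trace. [folklore] -/
theorem exists_central_neg :
    ∃ z : Matrix.specialUnitaryGroup (Fin 2) ℂ, (∀ x, z * x = x * z) ∧ (∀ x, reTr (z * x) = -reTr x) := by
  have hmem : (-1 : Matrix (Fin 2) (Fin 2) ℂ) ∈ Matrix.specialUnitaryGroup (Fin 2) ℂ := by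
    rw [Matrix.mem_specialUnitaryGroup_iff, Matrix.mem_unitaryGroup_iff]
    refine ⟨by simp, ?_⟩
    rw [Matrix.det_neg, Matrix.det_one, Fintype.card_fin]
    norm_num
  refine ⟨⟨-1, hmem⟩, fun x => Subtype.ext ?_, fun x => ?_⟩
  · change (-1 : Matrix (Fin 2) (Fin 2) ℂ) * (x : Matrix (Fin 2) (Fin 2) ℂ) = (x : Matrix (Fin 2) (Fin 2) ℂ) * (-1)
    rw [neg_one_mul, mul_neg_one]
  · rw [B16ZLower.reTr_specialUnitaryGroup, B16ZLower.reTr_specialUnitaryGroup, UnitaryModel.nReTr, UnitaryModel.nReTr]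
    change (Matrix.trace ((-1 : Matrix (Fin 2) (Fin 2) ℂ) * (x : Matrix (Fin 2) (Fin 2) ℂ))).re / _ = _
    rw [neg_one_mul, Matrix.trace_neg, Complex.neg_re, neg_div]

/-- The three pairs `k < l` of `Fin 3`. [folklore] -/
theorem filter_lt_fin_three :
    (Finset.univ.filter fun kl : Fin 3 × Fin 3 => kl.1 < kl.2) = {((0 : Fin 3), (1 : Fin 3)), (0, 2), (1, 2)} := by
  decide

/-- `Σ_{k<l} d(g_k,g_l) = d(g₀,g₁) + d(g₀,g₂) + d(g₁,g₂)` on `Fin 3`. [folklore] -/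
theorem sum_pairs_fin_three {G : Type*} [GaugeGroup G] (g : Fin 3 → G) :
    ∑ kl ∈ (Finset.univ.filter fun kl : Fin 3 × Fin 3 => kl.1 < kl.2), (1 - reTr (g kl.1 * g kl.2 * (g kl.1)⁻¹ * (g kl.2)⁻¹)) =
      (1 - reTr (g 0 * g 1 * (g 0)⁻¹ * (g 1)⁻¹)) + (1 - reTr (g 0 * g 2 * (g 0)⁻¹ * (g 2)⁻¹)) +
        (1 - reTr (g 1 * g 2 * (g 1)⁻¹ * (g 2)⁻¹)) := by
  rw [filter_lt_fin_three, Finset.sum_insert (by decide), Finset.sum_insert (by decide), Finset.sum_singleton]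
  ring

end Algebra

/-! ## §1 Pointwise: ordering by class angle and dropping one commutator -/

section Domination

/-- **ORDERING + DROPPING** (`s ≥ 0`): on `SU(2)³`,
`e^{−sΣ_{k<l}(1−reTr[g_k,g_l])}·Π_k 1[reTr g_k ≥ 0] ≤ Σ_m ρ(g_m)·Π_{l≠m} Φ(g_m,g_l)` with `ρ = 1[reTr ≥ 0]`,
`Φ(a,b) = 1[reTr a ≤ reTr b]·e^{−s(1−reTr[a,b])}`. [folklore] -/
theorem boltz_le_sum_three {s : ℝ} (hs : 0 ≤ s) (g : Fin 3 → Matrix.specialUnitaryGroup (Fin 2) ℂ)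
    (ρ : Matrix.specialUnitaryGroup (Fin 2) ℂ → ℝ≥0∞)
    (Φ : Matrix.specialUnitaryGroup (Fin 2) ℂ → Matrix.specialUnitaryGroup (Fin 2) ℂ → ℝ≥0∞)
    (hρ : ρ = fun a => {a : Matrix.specialUnitaryGroup (Fin 2) ℂ | 0 ≤ reTr a}.indicator 1 a)
    (hΦ : Φ = fun a b => {b : Matrix.specialUnitaryGroup (Fin 2) ℂ | reTr a ≤ reTr b}.indicator 1 b *
      ENNReal.ofReal (Real.exp (-(s * (1 - reTr (a * b * a⁻¹ * b⁻¹)))))) :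
    ENNReal.ofReal (Real.exp (-s * ∑ kl ∈ (Finset.univ.filter fun kl : Fin 3 × Fin 3 => kl.1 < kl.2),
        (1 - reTr (g kl.1 * g kl.2 * (g kl.1)⁻¹ * (g kl.2)⁻¹)))) *
      {g : Fin 3 → Matrix.specialUnitaryGroup (Fin 2) ℂ | 0 ≤ reTr (g 0)}.indicator 1 g *
      {g : Fin 3 → Matrix.specialUnitaryGroup (Fin 2) ℂ | 0 ≤ reTr (g 1)}.indicator 1 g *
      {g : Fin 3 → Matrix.specialUnitaryGroup (Fin 2) ℂ | 0 ≤ reTr (g 2)}.indicator 1 g ≤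
      ρ (g 0) * (Φ (g 0) (g 1) * Φ (g 0) (g 2)) + ρ (g 1) * (Φ (g 1) (g 0) * Φ (g 1) (g 2)) +
        ρ (g 2) * (Φ (g 2) (g 0) * Φ (g 2) (g 1)) := by
  classical
  by_cases hQ : ∀ k, 0 ≤ reTr (g k)
  · have hχ : ∀ k, {g : Fin 3 → Matrix.specialUnitaryGroup (Fin 2) ℂ | 0 ≤ reTr (g k)}.indicator
        (1 : (Fin 3 → Matrix.specialUnitaryGroup (Fin 2) ℂ) → ℝ≥0∞) g = 1 := fun k => by
      rw [Set.indicator_of_mem (show g ∈ {g : Fin 3 → Matrix.specialUnitaryGroup (Fin 2) ℂ | 0 ≤ reTr (g k)} from hQ k),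
        Pi.one_apply]
    rw [hχ 0, hχ 1, hχ 2, mul_one, mul_one, mul_one, sum_pairs_fin_three]
    obtain ⟨m, -, hm⟩ := Finset.exists_min_image Finset.univ (fun k => reTr (g k)) Finset.univ_nonempty
    have hρ1 : ρ (g m) = 1 := by
      rw [hρ]
      exact Set.indicator_of_mem (show g m ∈ {a : Matrix.specialUnitaryGroup (Fin 2) ℂ | 0 ≤ reTr a} from hQ m) _
    have hΦ1 : ∀ l, Φ (g m) (g l) = ENNReal.ofReal (Real.exp (-(s * (1 - reTr (g m * g l * (g m)⁻¹ * (g l)⁻¹))))) := by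
      intro l
      rw [hΦ]
      simp only
      rw [Set.indicator_of_mem (show g l ∈ {b : Matrix.specialUnitaryGroup (Fin 2) ℂ | reTr (g m) ≤ reTr b} from
        hm l (Finset.mem_univ l)), Pi.one_apply, one_mul]
    have hd : ∀ k l : Fin 3, 0 ≤ 1 - reTr (g k * g l * (g k)⁻¹ * (g l)⁻¹) := fun k l => sub_nonneg.2 (GaugeGroup.reTr_le_one _)
    have hexp2 : ∀ x y : ℝ, ENNReal.ofReal (Real.exp (-(s * x))) * ENNReal.ofReal (Real.exp (-(s * y))) =
        ENNReal.ofReal (Real.exp (-s * (x + y))) := fun x y => by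
      rw [← ENNReal.ofReal_mul (Real.exp_pos _).le, ← Real.exp_add]
      congr 1
      ring
    obtain hm0 | hm1 | hm2 : m = 0 ∨ m = 1 ∨ m = 2 := by fin_cases m <;> simp
    · subst hm0
      refine le_trans ?_ (le_add_right le_self_add)
      rw [hρ1, one_mul, hΦ1 1, hΦ1 2, hexp2]
      apply ENNReal.ofReal_le_ofReal
      apply Real.exp_le_exp.2
      nlinarith [hd 1 2, hs]
    · subst hm1
      refine le_trans ?_ (le_add_right le_add_self)
      rw [hρ1, one_mul, hΦ1 0, hΦ1 2, hexp2, reTr_comm_symm (g 1) (g 0)]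
      apply ENNReal.ofReal_le_ofReal
      apply Real.exp_le_exp.2
      nlinarith [hd 0 2, hs]
    · subst hm2
      refine le_trans ?_ le_add_self
      rw [hρ1, one_mul, hΦ1 0, hΦ1 1, hexp2, reTr_comm_symm (g 2) (g 0), reTr_comm_symm (g 2) (g 1)]
      apply ENNReal.ofReal_le_ofReal
      apply Real.exp_le_exp.2
      nlinarith [hd 0 1, hs]
  · push Not at hQ
    obtain ⟨k, hk⟩ := hQ
    have h0 : {g : Fin 3 → Matrix.specialUnitaryGroup (Fin 2) ℂ | 0 ≤ reTr (g k)}.indicator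
        (1 : (Fin 3 → Matrix.specialUnitaryGroup (Fin 2) ℂ) → ℝ≥0∞) g = 0 :=
      Set.indicator_of_notMem (show g ∉ {g : Fin 3 → Matrix.specialUnitaryGroup (Fin 2) ℂ | 0 ≤ reTr (g k)} from
        fun h => not_le.2 hk h) _
    obtain hk0 | hk1 | hk2 : k = 0 ∨ k = 1 ∨ k = 2 := by fin_cases k <;> simp
    · subst hk0; rw [h0, mul_zero, zero_mul, zero_mul]; exact bot_le
    · subst hk1; rw [h0, mul_zero, zero_mul]; exact bot_le
    · subst hk2; rw [h0, mul_zero]; exact bot_le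

end Domination

/-! ## §2 The theorem -/

section Main

/-- **★ THE `s⁻²` LAW IN `ℝ≥0∞` FORM** (`s > 0`):
`∫ e^{−sΣ_{k<l}(1−reTr[g_k,g_l])} dHaar³ ≤ 24·(3π³/32)²/(2π²)·s⁻²·∫_{|A|<π}‖A‖⁻²d³A`. [folklore] -/
theorem lintegral_boltz_three_le {s : ℝ} (hs : 0 < s) :
    ∫⁻ g, ENNReal.ofReal (Real.exp (-s * ∑ kl ∈ (Finset.univ.filter fun kl : Fin 3 × Fin 3 => kl.1 < kl.2),
        (1 - reTr (g kl.1 * g kl.2 * (g kl.1)⁻¹ * (g kl.2)⁻¹))))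
        ∂Measure.pi (fun _ : Fin 3 => haarProbability (Matrix.specialUnitaryGroup (Fin 2) ℂ)) ≤
      ENNReal.ofReal (24 * ((3 * π ^ 3 / 32) ^ 2 / (2 * π ^ 2) / s ^ 2 *
        ∫ A in Metric.ball (0 : EuclideanSpace ℝ (Fin 3)) π, (‖A‖ ^ 2)⁻¹)) := by
  classical
  haveI : Measure.IsHaarMeasure (haarProbability (Matrix.specialUnitaryGroup (Fin 2) ℂ)) := by
    unfold haarProbability; infer_instance
  haveI : IsProbabilityMeasure (haarProbability (Matrix.specialUnitaryGroup (Fin 2) ℂ)) :=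
    HaarData.isProb (G := Matrix.specialUnitaryGroup (Fin 2) ℂ)
  obtain ⟨z, hzc, hzr⟩ := exists_central_neg
  -- opaque names for the players
  obtain ⟨f, hf⟩ : ∃ f : (Fin 3 → Matrix.specialUnitaryGroup (Fin 2) ℂ) → ℝ≥0∞, f = fun g =>
      ENNReal.ofReal (Real.exp (-s * ∑ kl ∈ (Finset.univ.filter fun kl : Fin 3 × Fin 3 => kl.1 < kl.2),
        (1 - reTr (g kl.1 * g kl.2 * (g kl.1)⁻¹ * (g kl.2)⁻¹)))) := ⟨_, rfl⟩
  obtain ⟨ρ, hρ⟩ : ∃ ρ : Matrix.specialUnitaryGroup (Fin 2) ℂ → ℝ≥0∞,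
      ρ = fun a => {a : Matrix.specialUnitaryGroup (Fin 2) ℂ | 0 ≤ reTr a}.indicator 1 a := ⟨_, rfl⟩
  obtain ⟨Φ, hΦ⟩ : ∃ Φ : Matrix.specialUnitaryGroup (Fin 2) ℂ → Matrix.specialUnitaryGroup (Fin 2) ℂ → ℝ≥0∞,
      Φ = fun a b => {b : Matrix.specialUnitaryGroup (Fin 2) ℂ | reTr a ≤ reTr b}.indicator 1 b *
        ENNReal.ofReal (Real.exp (-(s * (1 - reTr (a * b * a⁻¹ * b⁻¹))))) := ⟨_, rfl⟩
  obtain ⟨χ, hχ⟩ : ∃ χ : Fin 3 → (Fin 3 → Matrix.specialUnitaryGroup (Fin 2) ℂ) → ℝ≥0∞,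
      χ = fun k g => {g : Fin 3 → Matrix.specialUnitaryGroup (Fin 2) ℂ | 0 ≤ reTr (g k)}.indicator 1 g := ⟨_, rfl⟩
  -- measurability
  have hfm : Measurable f := by
    rw [hf]
    refine ((Finset.measurable_sum _ fun kl _ => measurable_const.sub (RegularGaugeGroup.measurable_reTr.comp ?_)).const_mul
      (-s)).exp.ennreal_ofReal
    exact (((measurable_pi_apply kl.1).mul (measurable_pi_apply kl.2)).mul (measurable_pi_apply kl.1).inv).mul
      (measurable_pi_apply kl.2).inv
  have hχm : ∀ k, Measurable (χ k) := fun k => by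
    rw [hχ]
    exact measurable_one.indicator (measurableSet_le measurable_const (RegularGaugeGroup.measurable_reTr.comp (measurable_pi_apply k)))
  have hρm : Measurable ρ := by
    rw [hρ]; exact measurable_one.indicator (measurableSet_le measurable_const RegularGaugeGroup.measurable_reTr)
  have hΦm : Measurable (Function.uncurry Φ) := by
    rw [hΦ]
    change Measurable fun p : Matrix.specialUnitaryGroup (Fin 2) ℂ × Matrix.specialUnitaryGroup (Fin 2) ℂ =>
      {p : Matrix.specialUnitaryGroup (Fin 2) ℂ × Matrix.specialUnitaryGroup (Fin 2) ℂ | reTr p.1 ≤ reTr p.2}.indicator 1 p *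
        ENNReal.ofReal (Real.exp (-(s * (1 - reTr (p.1 * p.2 * p.1⁻¹ * p.2⁻¹)))))
    refine (measurable_one.indicator (measurableSet_le (RegularGaugeGroup.measurable_reTr.comp measurable_fst)
      (RegularGaugeGroup.measurable_reTr.comp measurable_snd))).mul ?_
    refine (Measurable.exp (Measurable.neg (Measurable.const_mul (measurable_const.sub
      (RegularGaugeGroup.measurable_reTr.comp ?_)) s))).ennreal_ofReal
    exact ((measurable_fst.mul measurable_snd).mul measurable_fst.inv).mul measurable_snd.inv
  have hΦ₂ : ∀ i j : Fin 3, Measurable fun x : Fin 3 → Matrix.specialUnitaryGroup (Fin 2) ℂ => Φ (x i) (x j) := by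
    intro i j
    have h := hΦm.comp ((measurable_pi_apply (X := fun _ : Fin 3 => Matrix.specialUnitaryGroup (Fin 2) ℂ) i).prodMk
      (measurable_pi_apply (X := fun _ : Fin 3 => Matrix.specialUnitaryGroup (Fin 2) ℂ) j))
    exact h
  have hTm : ∀ m a b : Fin 3, Measurable fun x : Fin 3 → Matrix.specialUnitaryGroup (Fin 2) ℂ =>
      ρ (x m) * (Φ (x m) (x a) * Φ (x m) (x b)) :=
    fun m a b => (hρm.comp (measurable_pi_apply m)).mul ((hΦ₂ m a).mul (hΦ₂ m b))
  have hψm : Measurable fun a => ∫⁻ b, Φ a b ∂haarProbability (Matrix.specialUnitaryGroup (Fin 2) ℂ) :=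
    hΦm.lintegral_prod_right
  -- the flips are central
  have hcent : ∀ (k a : Fin 3) (w : Matrix.specialUnitaryGroup (Fin 2) ℂ),
      Function.update (1 : Fin 3 → Matrix.specialUnitaryGroup (Fin 2) ℂ) k z a * w =
        w * Function.update (1 : Fin 3 → Matrix.specialUnitaryGroup (Fin 2) ℂ) k z a := by
    intro k a w
    by_cases h : a = k
    · subst h; rw [Function.update_self]; exact hzc w
    · rw [Function.update_of_ne h, Pi.one_apply, one_mul, mul_one]
  have hfinv : ∀ (k : Fin 3) (g : Fin 3 → Matrix.specialUnitaryGroup (Fin 2) ℂ),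
      f (Function.update (1 : Fin 3 → Matrix.specialUnitaryGroup (Fin 2) ℂ) k z * g) = f g := by
    intro k g
    have hs' : ∑ kl ∈ (Finset.univ.filter fun kl : Fin 3 × Fin 3 => kl.1 < kl.2),
        (1 - reTr ((Function.update (1 : Fin 3 → Matrix.specialUnitaryGroup (Fin 2) ℂ) k z * g) kl.1 *
          (Function.update (1 : Fin 3 → Matrix.specialUnitaryGroup (Fin 2) ℂ) k z * g) kl.2 *
          ((Function.update (1 : Fin 3 → Matrix.specialUnitaryGroup (Fin 2) ℂ) k z * g) kl.1)⁻¹ *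
          ((Function.update (1 : Fin 3 → Matrix.specialUnitaryGroup (Fin 2) ℂ) k z * g) kl.2)⁻¹)) =
        ∑ kl ∈ (Finset.univ.filter fun kl : Fin 3 × Fin 3 => kl.1 < kl.2),
          (1 - reTr (g kl.1 * g kl.2 * (g kl.1)⁻¹ * (g kl.2)⁻¹)) := by
      refine Finset.sum_congr rfl fun kl _ => ?_
      rw [Pi.mul_apply, Pi.mul_apply, comm_word_central _ _ _ _ (hcent k kl.1) (hcent k kl.2)]
    rw [hf]
    simp only
    rw [hs']
  have hχinv : ∀ (k j : Fin 3), k ≠ j → ∀ g : Fin 3 → Matrix.specialUnitaryGroup (Fin 2) ℂ,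
      χ j (Function.update (1 : Fin 3 → Matrix.specialUnitaryGroup (Fin 2) ℂ) k z * g) = χ j g := by
    intro k j hkj g
    rw [hχ]
    simp only [Set.indicator, Set.mem_setOf_eq, Pi.mul_apply, Function.update_of_ne (Ne.symm hkj), Pi.one_apply, one_mul]
  have hχ' : ∀ (k : Fin 3) (g : Fin 3 → Matrix.specialUnitaryGroup (Fin 2) ℂ),
      {g : Fin 3 → Matrix.specialUnitaryGroup (Fin 2) ℂ | 0 ≤ reTr (g k)}.indicator
        (1 : (Fin 3 → Matrix.specialUnitaryGroup (Fin 2) ℂ) → ℝ≥0∞) g = χ k g := fun k g => by rw [hχ]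
  -- (1) three halvings
  have h1 := lintegral_le_two_mul_lintegral_pos z hzr 0 f hfm (hfinv 0)
  have h2 := lintegral_le_two_mul_lintegral_pos z hzr 1 (fun g => f g * χ 0 g) (hfm.mul (hχm 0))
    (fun g => by rw [hfinv 1 g, hχinv 1 0 (by decide) g])
  have h3 := lintegral_le_two_mul_lintegral_pos z hzr 2 (fun g => f g * χ 0 g * χ 1 g) ((hfm.mul (hχm 0)).mul (hχm 1))
    (fun g => by rw [hfinv 2 g, hχinv 2 0 (by decide) g, hχinv 2 1 (by decide) g])
  simp_rw [hχ'] at h1 h2 h3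
  -- (2) pointwise domination
  have hdom : ∀ g : Fin 3 → Matrix.specialUnitaryGroup (Fin 2) ℂ, f g * χ 0 g * χ 1 g * χ 2 g ≤
      ρ (g 0) * (Φ (g 0) (g 1) * Φ (g 0) (g 2)) + ρ (g 1) * (Φ (g 1) (g 0) * Φ (g 1) (g 2)) +
        ρ (g 2) * (Φ (g 2) (g 0) * Φ (g 2) (g 1)) := by
    intro g
    have h := boltz_le_sum_three hs.le g ρ Φ hρ hΦ
    rw [hf, hχ]
    exact h
  -- (3) Tonelli: the three summands integrate to the same `I`
  have hI : ∀ m a b : Fin 3, m ≠ a → m ≠ b → a ≠ b →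
      ∫⁻ g, ρ (g m) * (Φ (g m) (g a) * Φ (g m) (g b))
          ∂Measure.pi (fun _ : Fin 3 => haarProbability (Matrix.specialUnitaryGroup (Fin 2) ℂ)) =
        ∫⁻ y, ρ y * ((∫⁻ b, Φ y b ∂haarProbability (Matrix.specialUnitaryGroup (Fin 2) ℂ)) *
          ∫⁻ b, Φ y b ∂haarProbability (Matrix.specialUnitaryGroup (Fin 2) ℂ))
          ∂haarProbability (Matrix.specialUnitaryGroup (Fin 2) ℂ) :=
    fun m a b hma hmb hab => lintegral_pi_three_eq _ ρ Φ hρm hΦm m a b hma hmb hab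
  -- (4) the chart bounds
  have hIle : ∫⁻ y, ρ y * ((∫⁻ b, Φ y b ∂haarProbability (Matrix.specialUnitaryGroup (Fin 2) ℂ)) *
        ∫⁻ b, Φ y b ∂haarProbability (Matrix.specialUnitaryGroup (Fin 2) ℂ))
        ∂haarProbability (Matrix.specialUnitaryGroup (Fin 2) ℂ) ≤
      ENNReal.ofReal ((3 * π ^ 3 / 32) ^ 2 / (2 * π ^ 2) / s ^ 2 *
        ∫ A in Metric.ball (0 : EuclideanSpace ℝ (Fin 3)) π, (‖A‖ ^ 2)⁻¹) := by
    have h := lintegral_pos_psi_sq_le hs (by positivity : (0 : ℝ) ≤ 3 * π ^ 3 / 32)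
      (fun a => ∫⁻ b, Φ a b ∂haarProbability (Matrix.specialUnitaryGroup (Fin 2) ℂ)) hψm (fun A hA hA0 => by
        rw [hΦ]
        exact psi_expPauli_le hs A hA hA0)
    rw [hρ]
    exact h
  -- (5) assemble
  have hsum : ∫⁻ g, f g * χ 0 g * χ 1 g * χ 2 g
      ∂Measure.pi (fun _ : Fin 3 => haarProbability (Matrix.specialUnitaryGroup (Fin 2) ℂ)) ≤
      3 * ENNReal.ofReal ((3 * π ^ 3 / 32) ^ 2 / (2 * π ^ 2) / s ^ 2 *
        ∫ A in Metric.ball (0 : EuclideanSpace ℝ (Fin 3)) π, (‖A‖ ^ 2)⁻¹) := by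
    calc ∫⁻ g, f g * χ 0 g * χ 1 g * χ 2 g ∂Measure.pi (fun _ : Fin 3 => haarProbability (Matrix.specialUnitaryGroup (Fin 2) ℂ))
        ≤ ∫⁻ g, (ρ (g 0) * (Φ (g 0) (g 1) * Φ (g 0) (g 2)) + ρ (g 1) * (Φ (g 1) (g 0) * Φ (g 1) (g 2)) +
            ρ (g 2) * (Φ (g 2) (g 0) * Φ (g 2) (g 1)))
            ∂Measure.pi (fun _ : Fin 3 => haarProbability (Matrix.specialUnitaryGroup (Fin 2) ℂ)) := lintegral_mono hdom
      _ = (∫⁻ g, ρ (g 0) * (Φ (g 0) (g 1) * Φ (g 0) (g 2))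
              ∂Measure.pi (fun _ : Fin 3 => haarProbability (Matrix.specialUnitaryGroup (Fin 2) ℂ))) +
          (∫⁻ g, ρ (g 1) * (Φ (g 1) (g 0) * Φ (g 1) (g 2))
              ∂Measure.pi (fun _ : Fin 3 => haarProbability (Matrix.specialUnitaryGroup (Fin 2) ℂ))) +
          ∫⁻ g, ρ (g 2) * (Φ (g 2) (g 0) * Φ (g 2) (g 1))
              ∂Measure.pi (fun _ : Fin 3 => haarProbability (Matrix.specialUnitaryGroup (Fin 2) ℂ)) := by
          rw [lintegral_add_right _ (hTm 2 0 1), lintegral_add_right _ (hTm 1 0 2)]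
      _ ≤ 3 * ENNReal.ofReal ((3 * π ^ 3 / 32) ^ 2 / (2 * π ^ 2) / s ^ 2 *
            ∫ A in Metric.ball (0 : EuclideanSpace ℝ (Fin 3)) π, (‖A‖ ^ 2)⁻¹) := by
          rw [hI 0 1 2 (by decide) (by decide) (by decide), hI 1 0 2 (by decide) (by decide) (by decide),
            hI 2 0 1 (by decide) (by decide) (by decide)]
          calc _ ≤ ENNReal.ofReal ((3 * π ^ 3 / 32) ^ 2 / (2 * π ^ 2) / s ^ 2 *
                  ∫ A in Metric.ball (0 : EuclideanSpace ℝ (Fin 3)) π, (‖A‖ ^ 2)⁻¹) +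
                ENNReal.ofReal ((3 * π ^ 3 / 32) ^ 2 / (2 * π ^ 2) / s ^ 2 *
                  ∫ A in Metric.ball (0 : EuclideanSpace ℝ (Fin 3)) π, (‖A‖ ^ 2)⁻¹) +
                ENNReal.ofReal ((3 * π ^ 3 / 32) ^ 2 / (2 * π ^ 2) / s ^ 2 *
                  ∫ A in Metric.ball (0 : EuclideanSpace ℝ (Fin 3)) π, (‖A‖ ^ 2)⁻¹) :=
                add_le_add (add_le_add hIle hIle) hIle
            _ = _ := by ring
  have h24 : (2 : ℝ≥0∞) * (2 * (2 * (3 * ENNReal.ofReal ((3 * π ^ 3 / 32) ^ 2 / (2 * π ^ 2) / s ^ 2 *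
      ∫ A in Metric.ball (0 : EuclideanSpace ℝ (Fin 3)) π, (‖A‖ ^ 2)⁻¹)))) =
      ENNReal.ofReal (24 * ((3 * π ^ 3 / 32) ^ 2 / (2 * π ^ 2) / s ^ 2 *
        ∫ A in Metric.ball (0 : EuclideanSpace ℝ (Fin 3)) π, (‖A‖ ^ 2)⁻¹)) := by
    rw [show (24 : ℝ) * ((3 * π ^ 3 / 32) ^ 2 / (2 * π ^ 2) / s ^ 2 *
        ∫ A in Metric.ball (0 : EuclideanSpace ℝ (Fin 3)) π, (‖A‖ ^ 2)⁻¹) =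
        2 * (2 * (2 * (3 * ((3 * π ^ 3 / 32) ^ 2 / (2 * π ^ 2) / s ^ 2 *
          ∫ A in Metric.ball (0 : EuclideanSpace ℝ (Fin 3)) π, (‖A‖ ^ 2)⁻¹)))) by ring,
      ENNReal.ofReal_mul (by norm_num : (0 : ℝ) ≤ 2), ENNReal.ofReal_mul (by norm_num : (0 : ℝ) ≤ 2),
      ENNReal.ofReal_mul (by norm_num : (0 : ℝ) ≤ 2), ENNReal.ofReal_mul (by norm_num : (0 : ℝ) ≤ 3),
      ENNReal.ofReal_ofNat, ENNReal.ofReal_ofNat]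
  calc ∫⁻ g, ENNReal.ofReal (Real.exp (-s * ∑ kl ∈ (Finset.univ.filter fun kl : Fin 3 × Fin 3 => kl.1 < kl.2),
          (1 - reTr (g kl.1 * g kl.2 * (g kl.1)⁻¹ * (g kl.2)⁻¹))))
          ∂Measure.pi (fun _ : Fin 3 => haarProbability (Matrix.specialUnitaryGroup (Fin 2) ℂ))
      = ∫⁻ g, f g ∂Measure.pi (fun _ : Fin 3 => haarProbability (Matrix.specialUnitaryGroup (Fin 2) ℂ)) := by rw [hf]
    _ ≤ 2 * ∫⁻ g, f g * χ 0 g ∂Measure.pi (fun _ : Fin 3 => haarProbability (Matrix.specialUnitaryGroup (Fin 2) ℂ)) := h1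
    _ ≤ 2 * (2 * ∫⁻ g, f g * χ 0 g * χ 1 g
          ∂Measure.pi (fun _ : Fin 3 => haarProbability (Matrix.specialUnitaryGroup (Fin 2) ℂ))) := mul_le_mul' le_rfl h2
    _ ≤ 2 * (2 * (2 * ∫⁻ g, f g * χ 0 g * χ 1 g * χ 2 g
          ∂Measure.pi (fun _ : Fin 3 => haarProbability (Matrix.specialUnitaryGroup (Fin 2) ℂ)))) :=
        mul_le_mul' le_rfl (mul_le_mul' le_rfl h3)
    _ ≤ 2 * (2 * (2 * (3 * ENNReal.ofReal ((3 * π ^ 3 / 32) ^ 2 / (2 * π ^ 2) / s ^ 2 *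
          ∫ A in Metric.ball (0 : EuclideanSpace ℝ (Fin 3)) π, (‖A‖ ^ 2)⁻¹)))) :=
        mul_le_mul' le_rfl (mul_le_mul' le_rfl (mul_le_mul' le_rfl hsum))
    _ = _ := h24

/-- **★★ THE `s⁻²` LAW**: `∃ C > 0, ∀ s > 0, ∫_{SU(2)³} exp(−s·Σ_{k<l}(1 − reTr[g_k,g_l])) dHaar³ ≤ C/s²`. [folklore] -/
theorem integral_boltz_three_le : ∃ C : ℝ, 0 < C ∧ ∀ s : ℝ, 0 < s →
    ∫ g, Real.exp (-s * ∑ kl ∈ (Finset.univ.filter fun kl : Fin 3 × Fin 3 => kl.1 < kl.2),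
        (1 - reTr (g kl.1 * g kl.2 * (g kl.1)⁻¹ * (g kl.2)⁻¹)))
        ∂Measure.pi (fun _ : Fin 3 => (HaarData.haar : Measure (Matrix.specialUnitaryGroup (Fin 2) ℂ))) ≤ C / s ^ 2 := by
  obtain ⟨B, hB⟩ : ∃ B : ℝ, B = (3 * π ^ 3 / 32) ^ 2 / (2 * π ^ 2) *
      ∫ A in Metric.ball (0 : EuclideanSpace ℝ (Fin 3)) π, (‖A‖ ^ 2)⁻¹ := ⟨_, rfl⟩
  have hB0 : 0 ≤ B := by
    rw [hB]
    exact mul_nonneg (by positivity) (setIntegral_nonneg measurableSet_ball fun A _ => by positivity)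
  refine ⟨24 * B + 1, by positivity, fun s hs => ?_⟩
  have hμ : (HaarData.haar : Measure (Matrix.specialUnitaryGroup (Fin 2) ℂ)) =
      haarProbability (Matrix.specialUnitaryGroup (Fin 2) ℂ) := rfl
  rw [hμ]
  have hmeasR : Measurable fun g : Fin 3 → Matrix.specialUnitaryGroup (Fin 2) ℂ => Real.exp (-s *
      ∑ kl ∈ (Finset.univ.filter fun kl : Fin 3 × Fin 3 => kl.1 < kl.2), (1 - reTr (g kl.1 * g kl.2 * (g kl.1)⁻¹ * (g kl.2)⁻¹))) := by
    refine ((Finset.measurable_sum _ fun kl _ => measurable_const.sub (RegularGaugeGroup.measurable_reTr.comp ?_)).const_mul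
      (-s)).exp
    exact (((measurable_pi_apply kl.1).mul (measurable_pi_apply kl.2)).mul (measurable_pi_apply kl.1).inv).mul
      (measurable_pi_apply kl.2).inv
  rw [integral_eq_lintegral_of_nonneg_ae (Filter.Eventually.of_forall fun g => (Real.exp_pos _).le) hmeasR.aestronglyMeasurable]
  have h := lintegral_boltz_three_le hs
  rw [show 24 * ((3 * π ^ 3 / 32) ^ 2 / (2 * π ^ 2) / s ^ 2 *
      ∫ A in Metric.ball (0 : EuclideanSpace ℝ (Fin 3)) π, (‖A‖ ^ 2)⁻¹) = 24 * B / s ^ 2 by rw [hB]; ring] at h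
  calc (∫⁻ g, ENNReal.ofReal (Real.exp (-s * ∑ kl ∈ (Finset.univ.filter fun kl : Fin 3 × Fin 3 => kl.1 < kl.2),
          (1 - reTr (g kl.1 * g kl.2 * (g kl.1)⁻¹ * (g kl.2)⁻¹))))
          ∂Measure.pi (fun _ : Fin 3 => haarProbability (Matrix.specialUnitaryGroup (Fin 2) ℂ))).toReal
      ≤ 24 * B / s ^ 2 := ENNReal.toReal_le_of_le_ofReal (by positivity) h
    _ ≤ (24 * B + 1) / s ^ 2 := by
        apply div_le_div_of_nonneg_right _ (by positivity)
        linarith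

/-- **★★★ THE `s⁻²` LAW, `Fin n` FORM FOR `n = 3`** (the shape consumed by `…LSharpUpperBound` with `n = (F.P K).d = 3`):
`∃ C > 0, ∀ n = 3, ∀ s > 0, ∫_{SU(2)^n} exp(−s·Σ_{k<l}(1 − reTr(g_k g_l g_k⁻¹ g_l⁻¹))) dHaar^{⊗n} ≤ C/s²`. [folklore] -/
theorem integral_boltz_le_of_eq_three : ∃ C : ℝ, 0 < C ∧ ∀ (n : ℕ), n = 3 → ∀ s : ℝ, 0 < s →
    ∫ g, Real.exp (-s * ∑ kl ∈ (Finset.univ.filter fun kl : Fin n × Fin n => kl.1 < kl.2),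
        (1 - reTr (g kl.1 * g kl.2 * (g kl.1)⁻¹ * (g kl.2)⁻¹)))
        ∂Measure.pi (fun _ : Fin n => (HaarData.haar : Measure (Matrix.specialUnitaryGroup (Fin 2) ℂ))) ≤ C / s ^ 2 := by
  obtain ⟨C, hC, h⟩ := integral_boltz_three_le
  refine ⟨C, hC, fun n hn s hs => ?_⟩
  subst hn
  exact h s hs

end Main

end Summit.QuantumFields.YangMills.Theorems.CoarseStiffnessTailCommVolumeUpper

end
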